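import Summits.QuantumFields.YangMills.Theorems.BalabanUVNodesN19JacksonMeanSecondOrder
import Mathlib.Analysis.SpecialFunctions.Trigonometric.Chebyshev.Basic
import Mathlib.Analysis.SpecialFunctions.Trigonometric.Inverse
import Mathlib.Data.Real.Sign

/-!
# YM-DAG node N19 (= NE7 proper) — KINK-EXACT, POLYNOMIALLY LOCALISED APPROXIMANTS OF `sgn x` AND `|x|` ON `[−1,1]`
# (`p_L = X·r_L`, `p_L(0) = 0`, `|p_L(x)| ≤ |x|`, `||x| − p_L(x)| ≤ min(2|x|, (π⁷∕3)∕(L³x²))`, degree `2L − 1`)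

Cell `pub-ymgap`, HUMAN RULING D-0062 (Track A) ∕ D-0149 (work-bound push), R141 (C) wider-strategy seat `pub-ymgap-dag-n19-e` (strategy
s3 = ALTERNATIVE CURRENCY), generation g36, module 1 (lineage module 196).  Route `Summits/QuantumFields/YangMills/Theses/BalabanUVNodes.lean`,
cluster item K3⁸ «SpineGivenEndpointR13SepCoPHV» (stmt-QuantumFields-27366); filed `--supports` that item `--as helper` (it proves no registered
stub).  COUNT-NEUTRAL: [folklore] one-dimensional harmonic analysis (pointwise ∕ localised estimates for Jackson means, DeVore–Lorentz style) over
Mathlib (`integral_zpow`, `Polynomial.Chebyshev.T_real_cos`, `Chebyshev.natDegree_T`, `Real.abs_cos_sub_cos_le`, `Real.sign`) and, BY NAME,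
`Literature.Probability.LatticeModels.FejerKernel` (`fejerKernel_le_div_sq`), module 150 `…N19FejerMean` (`continuous_fejerKernel`, `fejerKernel_neg`),
module 165 `…N19JacksonKernelMean` (`le_integral_fejerKernel_sq`, `jacksonMean_eq_trigSum`), module 185 `…N19JacksonMeanSecondOrder` (`abs_jacksonMean_le`);
no laws, no scheme object, no Theses import; NOT a discharge claim.

ROLE IN THE LINEAGE (HOME `numerics/OPEN-PROBLEM.md`, g36 addendum «model (M″)»).  g35 settled the ladder's FREE-BOX model (M′): on the box
`[−1,1]^{L+1}` of level variables the character `e^{iΩZ}`, `Z = Σ_l 2^{−l}θ_l`, costs weighted degree `Θ(Ω·log Ω)` — the logarithm of the general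
row is forced there.  The box is the right model ONLY for ladders whose inner approximants of `|x|` have an error of full size `≍ 1∕L` at the kink
(plain Fejér ∕ Jackson means: `p(0) ≍ 1∕L`): then the level statistics `θ_l = 2^l(A_{l+1} − A_l)` of a point near the kink are ALL of unit size.
This module supplies the alternative: inner approximants that are EXACT AT THE KINK with POLYNOMIALLY LOCALISED error,
  `p_L = X·r_L`,  `r_L(cos θ) = (1∕Z_L)∫_{−π}^{π} g_L(θ − v)·f_L(v)² dv`,  `g_L = max(−1, min(1, L·cos))` (the CLIPPED cosine),
`f_L²` the Jackson kernel of module 165: (§1) the localised tail estimate `|(J_L φ)(θ) − σ| ≤ π⁷∕(24L³δ³)` whenever `|φ| ≤ 1` and `φ(θ − v) = σ` for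
`|v| ≤ δ` (`f_L² ≤ π⁴∕(L²v⁴)`, `∫_δ^π v⁻⁴ ≤ 1∕(3δ³)`, `Z_L ≥ 32L∕π³`); (§2) for EVEN `φ` the Jackson mean is `r(cos θ)` with `r` an explicit combination of
Chebyshev polynomials `T_k`, `k ≤ 2L − 2` (the sine coefficients vanish); (§3) the clipped cosine is continuous, `2π`-periodic, even, bounded by `1`, and
EQUAL TO `sgn(cos θ)` on `|v| ≤ |cos θ|∕2` around `θ` as soon as `|cos θ| ≥ 2∕L`; (§4) ★ `exists_poly_near_sign_localized`: `r_L` of degree `≤ 2L − 2`,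
`|r_L| ≤ 1` on `[−1,1]`, `|sgn x − r_L(x)| ≤ (π⁷∕3)∕(L|x|)³` (`x ≠ 0`); ★★ `exists_kinkExact_poly_near_abs`: `p_L = X·r_L` of degree `≤ 2L − 1` with
`|p_L(x)| ≤ |x|`, `||x| − p_L(x)| ≤ 2|x|` and `||x| − p_L(x)| ≤ (π⁷∕3)∕(L³x²)` on `[−1,1]`.  The sequel `…N19LevelStatisticsCrossPolytope` sums the dyadic
increments: `Σ_l 2^l|p_{2^{l+1}}(x) − p_{2^l}(x)| ≤ 134` uniformly — the level statistics of a kink-exact ladder live in a CROSS-POLYTOPE (`ℓ¹`-ball),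
not in the box of (M′).

HONEST FRAMING (binding).  Elementary and [folklore] (localised Jackson estimates; constants crude: `π⁷∕3 ≈ 1007`); NO consumer in the DAG today (a
structural remark on the seat's own upper-bound method, degree model); nothing of Bałaban's instantiated; NE7 NOT PRINTED, NOT proved; N19 NOT
discharged; count-neutral.  One finite `T⁴` programme at fixed `ε`; nothing continuum ∕ `ℝ⁴` ∕ OS ∕ mass-gap ∕ Clay.  0 `def` ∕ 0 `sorry`.
-/

noncomputable section

open Finset MeasureTheory intervalIntegral Polynomial
open scoped Real

namespace Summit.QuantumFields.YangMills.Theorems.BalabanUVNodesN19KinkExactSignJackson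

open Literature.Probability.LatticeModels (fejerKernel fejerKernel_nonneg fejerKernel_le fejerKernel_le_div_sq)
open Summit.QuantumFields.YangMills.Theorems.BalabanUVNodesN19FejerMean (continuous_fejerKernel fejerKernel_neg)
open Summit.QuantumFields.YangMills.Theorems.BalabanUVNodesN19JacksonKernelMean (le_integral_fejerKernel_sq jacksonMean_eq_trigSum)
open Summit.QuantumFields.YangMills.Theorems.BalabanUVNodesN19JacksonMeanSecondOrder (abs_jacksonMean_le)

/-! ## §1 The localised tail estimate for the Jackson mean [folklore] -/

/-- `∫_δ^π v⁻⁴ dv ≤ 1∕(3δ³)` for `0 < δ ≤ π`. [folklore] -/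
theorem integral_zpow_neg_four_le {δ : ℝ} (hδ0 : 0 < δ) (hδπ : δ ≤ π) :
    ∫ v in δ..π, v ^ (-4 : ℤ) ≤ 1 / (3 * δ ^ 3) := by
  have h0 : (0 : ℝ) ∉ Set.uIcc δ π := by
    rw [Set.uIcc_of_le hδπ]; exact fun h => by linarith [h.1]
  rw [integral_zpow (Or.inr ⟨by norm_num, h0⟩)]
  have e : (-4 : ℤ) + 1 = -3 := by norm_num
  rw [e, zpow_neg, zpow_neg, zpow_ofNat, zpow_ofNat]
  push_cast
  rw [show ((-4 : ℝ) + 1) = -3 by norm_num]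
  have hπ3 : 0 < π ^ 3 := by positivity
  have hδ3 : 0 < δ ^ 3 := by positivity
  have key : ((π ^ 3)⁻¹ - (δ ^ 3)⁻¹) / (-3 : ℝ) = ((δ ^ 3)⁻¹ - (π ^ 3)⁻¹) / 3 := by ring
  rw [key]
  have h1 : 0 ≤ (π ^ 3)⁻¹ := by positivity
  have h2 : (δ ^ 3)⁻¹ / 3 = 1 / (3 * δ ^ 3) := by field_simp
  calc ((δ ^ 3)⁻¹ - (π ^ 3)⁻¹) / 3 ≤ (δ ^ 3)⁻¹ / 3 := by linarith
    _ = 1 / (3 * δ ^ 3) := h2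

/-- The same on the left: `∫_{−π}^{−δ} v⁻⁴ dv ≤ 1∕(3δ³)` (`v⁻⁴` is even). [folklore] -/
theorem integral_zpow_neg_four_le_left {δ : ℝ} (hδ0 : 0 < δ) (hδπ : δ ≤ π) :
    ∫ v in (-π)..(-δ), v ^ (-4 : ℤ) ≤ 1 / (3 * δ ^ 3) := by
  have e : ∫ v in (-π)..(-δ), v ^ (-4 : ℤ) = ∫ v in δ..π, v ^ (-4 : ℤ) := by
    rw [← intervalIntegral.integral_comp_neg fun v : ℝ => v ^ (-4 : ℤ)]
    refine intervalIntegral.integral_congr fun v _ => ?_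
    exact (Even.neg_zpow (by decide) v)
  rw [e]; exact integral_zpow_neg_four_le hδ0 hδπ

/-- **THE LOCALISED TAIL ESTIMATE.**  Let `φ` be continuous with `|φ| ≤ 1`, `L ≥ 1`, `0 < δ ≤ π`, and suppose `φ(θ − v) = σ` for all `|v| ≤ δ`.
Then the Jackson mean `(1∕Z_L)∫_{−π}^{π} φ(θ − v)f_L(v)² dv` is within `π⁷∕(24·L³·δ³)` of `σ`: the integrand of `(1∕Z_L)∫(φ(θ−v) − σ)f_L²`
vanishes on `|v| ≤ δ` and is `≤ 2π⁴∕(L²v⁴)` beyond (`f_L ≤ π²∕(Lv²)`), `∫_δ^π v⁻⁴ ≤ 1∕(3δ³)` on each side, and `Z_L ≥ 32L∕π³`. [folklore] -/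
theorem abs_jacksonMean_sub_le_of_locallyConst {φ : ℝ → ℝ} (hφc : Continuous φ) (hφ : ∀ w, |φ w| ≤ 1) {L : ℕ} (hL : 1 ≤ L)
    {θ σ δ : ℝ} (hδ0 : 0 < δ) (hδπ : δ ≤ π) (hloc : ∀ v, |v| ≤ δ → φ (θ - v) = σ) :
    |(1 / ∫ v in (-π)..π, fejerKernel L v ^ 2) * (∫ v in (-π)..π, φ (θ - v) * fejerKernel L v ^ 2) - σ| ≤
      π ^ 7 / (24 * L ^ 3 * δ ^ 3) := by
  have hπ := Real.pi_pos
  have hLr : (0 : ℝ) < L := by exact_mod_cast hL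
  set Z : ℝ := ∫ v in (-π)..π, fejerKernel L v ^ 2 with hZ
  have hZlow := le_integral_fejerKernel_sq hL
  have hZ0 : 0 < Z := lt_of_lt_of_le (by positivity) hZlow
  have hσ : |σ| ≤ 1 := by
    have h := hloc 0 (by rw [abs_zero]; exact hδ0.le)
    rw [sub_zero] at h
    rw [← h]; exact hφ θ
  have hK : Continuous fun v : ℝ => fejerKernel L v ^ 2 := (continuous_fejerKernel L).pow 2
  have hφθ : Continuous fun v => φ (θ - v) := hφc.comp (continuous_const.sub continuous_id)
  set F : ℝ → ℝ := fun v => (φ (θ - v) - σ) * fejerKernel L v ^ 2 with hF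
  have hFc : Continuous F := (hφθ.sub continuous_const).mul hK
  have hFi : ∀ a b : ℝ, IntervalIntegrable F volume a b := fun a b => hFc.intervalIntegrable _ _
  -- rewrite the difference as `(1/Z) ∫ F`
  have hI1 : IntervalIntegrable (fun v => φ (θ - v) * fejerKernel L v ^ 2) volume (-π) π := (hφθ.mul hK).intervalIntegrable _ _
  have hI2 : IntervalIntegrable (fun v => σ * fejerKernel L v ^ 2) volume (-π) π := (continuous_const.mul hK).intervalIntegrable _ _
  have hsub : ∫ v in (-π)..π, F v = (∫ v in (-π)..π, φ (θ - v) * fejerKernel L v ^ 2) - ∫ v in (-π)..π, σ * fejerKernel L v ^ 2 := by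
    rw [← intervalIntegral.integral_sub hI1 hI2]
    exact intervalIntegral.integral_congr fun v _ => by simp only [hF]; ring
  have hc2 : ∫ v in (-π)..π, σ * fejerKernel L v ^ 2 = σ * Z := by rw [intervalIntegral.integral_const_mul]
  have hdiff : (1 / Z) * (∫ v in (-π)..π, φ (θ - v) * fejerKernel L v ^ 2) - σ = (1 / Z) * ∫ v in (-π)..π, F v := by
    rw [hsub, hc2]; field_simp
  rw [hdiff, abs_mul, abs_of_pos (by positivity : (0 : ℝ) < 1 / Z)]
  -- split the integral at `±δ`
  have hsplit : ∫ v in (-π)..π, F v = (∫ v in (-π)..(-δ), F v) + ((∫ v in (-δ)..δ, F v) + ∫ v in δ..π, F v) := by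
    rw [intervalIntegral.integral_add_adjacent_intervals (hFi _ _) (hFi _ _),
      intervalIntegral.integral_add_adjacent_intervals (hFi _ _) (hFi _ _)]
  -- the middle vanishes
  have hmid : ∫ v in (-δ)..δ, F v = 0 := by
    have : ∫ v in (-δ)..δ, F v = ∫ _v in (-δ)..δ, (0 : ℝ) := by
      refine intervalIntegral.integral_congr fun v hv => ?_
      rw [Set.uIcc_of_le (by linarith)] at hv
      have hvδ : |v| ≤ δ := abs_le.2 ⟨by linarith [hv.1], hv.2⟩
      simp only [hF, hloc v hvδ, sub_self, zero_mul]
    rw [this, intervalIntegral.integral_const, smul_zero]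
  -- pointwise bound on the tails
  have hbd : ∀ v : ℝ, δ ≤ |v| → |v| ≤ π → ‖F v‖ ≤ (2 * π ^ 4 / L ^ 2) * v ^ (-4 : ℤ) := by
    intro v hv1 hv2
    have hv0 : v ≠ 0 := fun h => by rw [h, abs_zero] at hv1; linarith
    have hd := fejerKernel_le_div_sq hL hv0 hv2
    have hf2 : fejerKernel L v ^ 2 ≤ (π ^ 2 / (L * v ^ 2)) ^ 2 := pow_le_pow_left₀ (fejerKernel_nonneg L v) hd 2
    have h1 : |φ (θ - v) - σ| ≤ 2 := by
      calc |φ (θ - v) - σ| ≤ |φ (θ - v)| + |σ| := abs_sub _ _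
        _ ≤ 1 + 1 := add_le_add (hφ _) hσ
        _ = 2 := by norm_num
    rw [Real.norm_eq_abs, hF]
    simp only
    rw [abs_mul, abs_of_nonneg (by positivity : 0 ≤ fejerKernel L v ^ 2)]
    have hv2' : 0 < v ^ 2 := by positivity
    calc |φ (θ - v) - σ| * fejerKernel L v ^ 2 ≤ 2 * (π ^ 2 / (L * v ^ 2)) ^ 2 :=
          mul_le_mul h1 hf2 (by positivity) (by norm_num)
      _ = (2 * π ^ 4 / L ^ 2) * v ^ (-4 : ℤ) := by
          rw [zpow_neg, zpow_ofNat]; field_simp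
  -- right tail
  have hright : ‖∫ v in δ..π, F v‖ ≤ (2 * π ^ 4 / L ^ 2) * (1 / (3 * δ ^ 3)) := by
    have h0 : (0 : ℝ) ∉ Set.uIcc δ π := by
      rw [Set.uIcc_of_le hδπ]; exact fun h => by linarith [h.1]
    have h1 : ‖∫ v in δ..π, F v‖ ≤ ∫ v in δ..π, (2 * π ^ 4 / L ^ 2) * v ^ (-4 : ℤ) := by
      refine intervalIntegral.norm_integral_le_of_norm_le hδπ (ae_of_all _ fun v hv => ?_)
        ((intervalIntegral.intervalIntegrable_zpow (Or.inr h0)).const_mul _)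
      have hv0 : 0 < v := hδ0.trans_le hv.1.le
      exact hbd v (by rw [abs_of_pos hv0]; exact hv.1.le) (by rw [abs_of_pos hv0]; exact hv.2)
    rw [intervalIntegral.integral_const_mul] at h1
    exact h1.trans (mul_le_mul_of_nonneg_left (integral_zpow_neg_four_le hδ0 hδπ) (by positivity))
  -- left tail
  have hleft : ‖∫ v in (-π)..(-δ), F v‖ ≤ (2 * π ^ 4 / L ^ 2) * (1 / (3 * δ ^ 3)) := by
    have h0 : (0 : ℝ) ∉ Set.uIcc (-π) (-δ) := by
      rw [Set.uIcc_of_le (by linarith)]; exact fun h => by linarith [h.2]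
    have h1 : ‖∫ v in (-π)..(-δ), F v‖ ≤ ∫ v in (-π)..(-δ), (2 * π ^ 4 / L ^ 2) * v ^ (-4 : ℤ) := by
      refine intervalIntegral.norm_integral_le_of_norm_le (by linarith) (ae_of_all _ fun v hv => ?_)
        ((intervalIntegral.intervalIntegrable_zpow (Or.inr h0)).const_mul _)
      have hv0 : v < 0 := lt_of_le_of_lt hv.2 (by linarith)
      exact hbd v (by rw [abs_of_neg hv0]; linarith [hv.2]) (by rw [abs_of_neg hv0]; linarith [hv.1])
    rw [intervalIntegral.integral_const_mul] at h1
    exact h1.trans (mul_le_mul_of_nonneg_left (integral_zpow_neg_four_le_left hδ0 hδπ) (by positivity))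
  have htot : |∫ v in (-π)..π, F v| ≤ 4 * π ^ 4 / (3 * L ^ 2 * δ ^ 3) := by
    rw [hsplit, hmid, zero_add]
    calc |(∫ v in (-π)..(-δ), F v) + ∫ v in δ..π, F v| ≤ |∫ v in (-π)..(-δ), F v| + |∫ v in δ..π, F v| := abs_add_le _ _
      _ ≤ (2 * π ^ 4 / L ^ 2) * (1 / (3 * δ ^ 3)) + (2 * π ^ 4 / L ^ 2) * (1 / (3 * δ ^ 3)) := by
          rw [← Real.norm_eq_abs, ← Real.norm_eq_abs]; exact add_le_add hleft hright
      _ = 4 * π ^ 4 / (3 * L ^ 2 * δ ^ 3) := by field_simp; ring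
  calc 1 / Z * |∫ v in (-π)..π, F v| ≤ 1 / Z * (4 * π ^ 4 / (3 * L ^ 2 * δ ^ 3)) := mul_le_mul_of_nonneg_left htot (by positivity)
    _ = (4 * π ^ 4 / (3 * L ^ 2 * δ ^ 3)) / Z := by ring
    _ ≤ (4 * π ^ 4 / (3 * L ^ 2 * δ ^ 3)) / (32 * L / π ^ 3) := div_le_div_of_nonneg_left (by positivity) (by positivity) hZlow
    _ = π ^ 7 / (24 * L ^ 3 * δ ^ 3) := by field_simp; ring


/-! ## §2 Even functions: the Jackson mean is a polynomial in `cos θ` [folklore] -/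

/-- The sine coefficients of an even function vanish: `∫_{−π}^{π} φ(w) sin(kw) dw = 0`. [folklore] -/
theorem integral_mul_sin_eq_zero_of_even {φ : ℝ → ℝ} (heven : ∀ w, φ (-w) = φ w) (k : ℝ) :
    ∫ w in (-π)..π, φ w * Real.sin (k * w) = 0 := by
  have h := intervalIntegral.integral_comp_neg (a := -π) (b := π) (fun w : ℝ => φ w * Real.sin (k * w))
  simp only [neg_neg] at h
  have h2 : (fun w : ℝ => φ (-w) * Real.sin (k * -w)) = fun w => -(φ w * Real.sin (k * w)) := by
    funext w; rw [heven, mul_neg, Real.sin_neg]; ring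
  rw [h2, intervalIntegral.integral_neg] at h
  linarith

/-- **FOR AN EVEN FUNCTION THE JACKSON MEAN IS A POLYNOMIAL IN `cos θ` OF DEGREE `≤ 2L − 2`.**  For `φ` continuous, `2π`-periodic and even, and
`L ≥ 1`, there is a real polynomial `r` with `deg r ≤ 2L − 2` and `(1∕Z)∫_{−π}^{π} φ(θ − v)f_L(v)² dv = r(cos θ)` for every `θ` (any normalisation `Z`):
module 165's trigonometric sum has no sine terms, and `cos(kθ) = T_k(cos θ)`. [folklore] -/
theorem exists_chebyshev_eval_eq_jacksonMean {φ : ℝ → ℝ} (hfc : Continuous φ) (hper : Function.Periodic φ (2 * π))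
    (heven : ∀ w, φ (-w) = φ w) {L : ℕ} (hL : 1 ≤ L) (Z : ℝ) :
    ∃ r : ℝ[X], r.natDegree ≤ 2 * L - 2 ∧
      ∀ θ : ℝ, (1 / Z) * ∫ v in (-π)..π, φ (θ - v) * fejerKernel L v ^ 2 = r.eval (Real.cos θ) := by
  classical
  set Q := (range L ×ˢ range L) ×ˢ (range L ×ˢ range L) with hQ
  -- the two modes of a quadruple
  set kp : (ℕ × ℕ) × (ℕ × ℕ) → ℕ := fun q => ((q.1.1 : ℤ) - q.1.2).natAbs + ((q.2.1 : ℤ) - q.2.2).natAbs with hkp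
  set km : (ℕ × ℕ) × (ℕ × ℕ) → ℕ := fun q => ((((q.1.1 : ℤ) - q.1.2).natAbs : ℤ) - ((q.2.1 : ℤ) - q.2.2).natAbs).natAbs with hkm
  set Cc : ℕ → ℝ := fun k => ∫ w in (-π)..π, φ w * Real.cos ((k : ℝ) * w) with hCc
  refine ⟨∑ q ∈ Q, Polynomial.C (1 / (2 * (L : ℝ) ^ 2 * Z)) *
      (Polynomial.C (Cc (kp q)) * Chebyshev.T ℝ ((kp q : ℕ) : ℤ) + Polynomial.C (Cc (km q)) * Chebyshev.T ℝ ((km q : ℕ) : ℤ)), ?_, ?_⟩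
  · refine natDegree_sum_le_of_forall_le _ _ fun q hq => ?_
    refine (natDegree_C_mul_le _ _).trans ((natDegree_add_le _ _).trans (max_le ?_ ?_))
    · refine (natDegree_C_mul_le _ _).trans ?_
      rw [Chebyshev.natDegree_T]
      simp only [hQ, Finset.mem_product, Finset.mem_range] at hq
      simp only [hkp, Int.natAbs_natCast]
      omega
    · refine (natDegree_C_mul_le _ _).trans ?_
      rw [Chebyshev.natDegree_T]
      simp only [hQ, Finset.mem_product, Finset.mem_range] at hq
      simp only [hkm, Int.natAbs_natCast]
      omega
  · intro θ
    rw [jacksonMean_eq_trigSum hfc hper L Z θ, Polynomial.eval_finsetSum]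
    refine Finset.sum_congr rfl fun q _ => ?_
    have hs1 := integral_mul_sin_eq_zero_of_even heven ((kp q : ℕ) : ℝ)
    have hs2 := integral_mul_sin_eq_zero_of_even heven ((km q : ℕ) : ℝ)
    simp only [hkp, hkm] at hs1 hs2
    simp only [Polynomial.eval_mul, Polynomial.eval_C, Polynomial.eval_add, Polynomial.Chebyshev.T_real_cos, Int.cast_natCast,
      hCc, hkp, hkm]
    rw [hs1, hs2]
    ring

/-! ## §3 The clipped cosine `g_L = max(−1, min(1, L·cos θ))` [bookkeeping] -/

/-- The clipped cosine is continuous. [bookkeeping] -/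
theorem continuous_clipCos (L : ℕ) : Continuous fun θ : ℝ => max (-1) (min 1 ((L : ℝ) * Real.cos θ)) :=
  continuous_const.max (continuous_const.min (continuous_const.mul Real.continuous_cos))

/-- The clipped cosine is `2π`-periodic. [bookkeeping] -/
theorem periodic_clipCos (L : ℕ) : Function.Periodic (fun θ : ℝ => max (-1) (min 1 ((L : ℝ) * Real.cos θ))) (2 * π) := by
  intro θ; simp only [Real.cos_add_two_pi]

/-- The clipped cosine is even. [bookkeeping] -/
theorem clipCos_neg (L : ℕ) (θ : ℝ) :
    max (-1) (min 1 ((L : ℝ) * Real.cos (-θ))) = max (-1) (min 1 ((L : ℝ) * Real.cos θ)) := by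
  rw [Real.cos_neg]

/-- The clipped cosine is bounded by `1`. [bookkeeping] -/
theorem abs_clipCos_le (L : ℕ) (θ : ℝ) : |max (-1) (min 1 ((L : ℝ) * Real.cos θ))| ≤ 1 :=
  abs_le.2 ⟨le_max_left _ _, max_le (by norm_num) (min_le_left _ _)⟩

/-- **LOCAL CONSTANCY AWAY FROM THE KINK.**  If `x = cos θ` has `|x| ≥ 2∕L` (`L ≥ 1`), then for `|v| ≤ |x|∕2` the clipped cosine at `θ − v` equals
`sgn x`: `|cos(θ − v) − cos θ| ≤ |v|` keeps `cos(θ − v)` on the side of `x` with `|cos(θ − v)| ≥ |x|∕2 ≥ 1∕L`. [bookkeeping] -/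
theorem clipCos_eq_sign {L : ℕ} (hL : 1 ≤ L) {θ : ℝ} (hx : 2 / (L : ℝ) ≤ |Real.cos θ|) {v : ℝ} (hv : |v| ≤ |Real.cos θ| / 2) :
    max (-1) (min 1 ((L : ℝ) * Real.cos (θ - v))) = Real.sign (Real.cos θ) := by
  have hLr : (0 : ℝ) < L := by exact_mod_cast hL
  have hclose : |Real.cos (θ - v) - Real.cos θ| ≤ |Real.cos θ| / 2 := by
    refine (Real.abs_cos_sub_cos_le _ _).trans ?_
    rw [show θ - v - θ = -v by ring, abs_neg]; exact hv
  have h2L : 1 ≤ (L : ℝ) * (|Real.cos θ| / 2) := by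
    have : 2 / (L : ℝ) * L ≤ |Real.cos θ| * L := mul_le_mul_of_nonneg_right hx hLr.le
    rw [div_mul_cancel₀ _ hLr.ne'] at this
    linarith
  rcases lt_trichotomy (Real.cos θ) 0 with hneg | hzero | hpos
  · rw [Real.sign_of_neg hneg]
    rw [abs_of_neg hneg] at hclose h2L
    have hc : Real.cos (θ - v) ≤ Real.cos θ / 2 := by
      have := (abs_le.1 hclose).2; linarith
    have hLc : (L : ℝ) * Real.cos (θ - v) ≤ -1 := by
      have := mul_le_mul_of_nonneg_left hc hLr.le
      linarith
    rw [min_eq_right (by linarith), max_eq_left hLc]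
  · exfalso
    rw [hzero, abs_zero] at hx
    have : (0 : ℝ) < 2 / L := by positivity
    linarith
  · rw [Real.sign_of_pos hpos]
    rw [abs_of_pos hpos] at hclose h2L
    have hc : Real.cos θ / 2 ≤ Real.cos (θ - v) := by
      have := (abs_le.1 hclose).1; linarith
    have hLc : 1 ≤ (L : ℝ) * Real.cos (θ - v) := by
      have := mul_le_mul_of_nonneg_left hc hLr.le
      linarith
    rw [min_eq_left hLc, max_eq_right (by norm_num)]

/-! ## §4 The sign polynomial and the kink-exact approximant of `|x|` [folklore] -/

/-- `x · sgn x = |x|`. [bookkeeping] -/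
theorem self_mul_sign_eq_abs (x : ℝ) : x * Real.sign x = |x| := by
  rcases lt_trichotomy x 0 with h | h | h
  · rw [Real.sign_of_neg h, abs_of_neg h]; ring
  · rw [h]; simp
  · rw [Real.sign_of_pos h, abs_of_pos h]; ring

/-- ★ **A POLYNOMIAL SIGN WITH POLYNOMIALLY LOCALISED ERROR.**  For every `L ≥ 1` there is a real polynomial `r` of degree `≤ 2L − 2` with
`|r(x)| ≤ 1` on `[−1,1]` and `|sgn x − r(x)| ≤ (π⁷∕3)∕(L·|x|)³` for every `x ∈ [−1,1]`, `x ≠ 0`: `r(cos θ)` is the Jackson mean of the clipped cosine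
`max(−1, min(1, L cos θ))` (§2, §3); for `|x| ≥ 2∕L` the localised tail estimate of §1 with `δ = |x|∕2` gives `π⁷·8∕(24L³|x|³)`; for `|x| < 2∕L` the
bound exceeds `2 ≥ |sgn x| + |r(x)|` (`π⁷∕3 ≥ 16`). [folklore] -/
theorem exists_poly_near_sign_localized {L : ℕ} (hL : 1 ≤ L) :
    ∃ r : ℝ[X], r.natDegree ≤ 2 * L - 2 ∧ (∀ x : ℝ, x ∈ Set.Icc (-1 : ℝ) 1 → |r.eval x| ≤ 1) ∧
      ∀ x : ℝ, x ∈ Set.Icc (-1 : ℝ) 1 → x ≠ 0 → |Real.sign x - r.eval x| ≤ (π ^ 7 / 3) / ((L : ℝ) * |x|) ^ 3 := by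
  have hπ := Real.pi_pos
  have hπ3 : (3 : ℝ) < π := Real.pi_gt_three
  have hLr : (0 : ℝ) < L := by exact_mod_cast hL
  -- `|sgn x| ≤ 1` (= `Literature.Analysis.FunctionSpaces.BMOInv.abs_real_sign_le_one`, re-derived inline to keep the imports light)
  have abs_sign_le_one : ∀ y : ℝ, |Real.sign y| ≤ 1 := fun y => by
    rcases Real.sign_apply_eq y with h | h | h <;> rw [h] <;> norm_num
  set Z : ℝ := ∫ v in (-π)..π, fejerKernel L v ^ 2 with hZ
  obtain ⟨r, hdeg, hr⟩ := exists_chebyshev_eval_eq_jacksonMean (continuous_clipCos L) (periodic_clipCos L) (clipCos_neg L) hL Z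
  refine ⟨r, hdeg, fun x hx => ?_, fun x hx hx0 => ?_⟩
  · rw [← Real.cos_arccos hx.1 hx.2, ← hr]
    exact abs_jacksonMean_le (abs_clipCos_le L) hL _
  · set θ : ℝ := Real.arccos x with hθ
    have hcos : Real.cos θ = x := Real.cos_arccos hx.1 hx.2
    have habs : 0 < |x| := abs_pos.2 hx0
    have hx1 : |x| ≤ 1 := abs_le.2 ⟨hx.1, hx.2⟩
    by_cases hbig : 2 / (L : ℝ) ≤ |x|
    · -- localised tail estimate with `δ = |x|/2`
      have hxθ : 2 / (L : ℝ) ≤ |Real.cos θ| := by rw [hcos]; exact hbig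
      have hloc : ∀ v : ℝ, |v| ≤ |x| / 2 → max (-1) (min 1 ((L : ℝ) * Real.cos (θ - v))) = Real.sign x := by
        intro v hv
        rw [← hcos] at hv ⊢
        exact clipCos_eq_sign hL hxθ hv
      have key := abs_jacksonMean_sub_le_of_locallyConst (continuous_clipCos L) (abs_clipCos_le L) hL
        (θ := θ) (σ := Real.sign x) (δ := |x| / 2) (by positivity) (by linarith) hloc
      rw [hr θ, hcos] at key
      rw [abs_sub_comm]
      refine key.trans (le_of_eq ?_)
      field_simp
      ring
    · -- trivial regime `|x| < 2/L`
      rw [not_le] at hbig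
      have h2 : |Real.sign x - r.eval x| ≤ 2 := by
        calc |Real.sign x - r.eval x| ≤ |Real.sign x| + |r.eval x| := abs_sub _ _
          _ ≤ 1 + 1 := add_le_add (abs_sign_le_one x) (by
              rw [← hcos, ← hr]; exact abs_jacksonMean_le (abs_clipCos_le L) hL _)
          _ = 2 := by norm_num
      refine h2.trans ?_
      rw [le_div_iff₀ (by positivity)]
      have hLx : (L : ℝ) * |x| < 2 := by
        have := mul_lt_mul_of_pos_left hbig hLr
        rwa [mul_div_cancel₀ _ hLr.ne'] at this
      have hLx0 : 0 ≤ (L : ℝ) * |x| := by positivity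
      have h8 : ((L : ℝ) * |x|) ^ 3 ≤ 8 := by
        have := pow_le_pow_left₀ hLx0 hLx.le 3
        norm_num at this; exact this
      have hπ7 : (2187 : ℝ) ≤ π ^ 7 := by
        have : (3 : ℝ) ^ 7 ≤ π ^ 7 := pow_le_pow_left₀ (by norm_num) hπ3.le 7
        norm_num at this; linarith
      nlinarith [h8, hπ7]

/-- ★★ **THE KINK-EXACT, POLYNOMIALLY LOCALISED APPROXIMANT OF `|x|`.**  For every `L ≥ 1` there is a real polynomial `p` of degree `≤ 2L − 1` with,
for all `x ∈ [−1,1]`: `|p(x)| ≤ |x|` (so `p(0) = 0`), `||x| − p(x)| ≤ 2|x|`, and `||x| − p(x)| ≤ (π⁷∕3)∕(L³·x²)` for `x ≠ 0`: `p = X·r` with the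
sign polynomial `r` of `exists_poly_near_sign_localized`, `|x| − x·r(x) = x·(sgn x − r(x))`.  (The error is `≲ min(|x|, 1∕(L³x²))`: of size `≍ 1∕L` only in
the window `|x| ≍ 1∕L`, decaying like `|x|` towards the kink and like `|x|⁻²` away from it.) [folklore] -/
theorem exists_kinkExact_poly_near_abs {L : ℕ} (hL : 1 ≤ L) :
    ∃ p : ℝ[X], p.natDegree ≤ 2 * L - 1 ∧ (∀ x : ℝ, x ∈ Set.Icc (-1 : ℝ) 1 → |p.eval x| ≤ |x|) ∧
      (∀ x : ℝ, x ∈ Set.Icc (-1 : ℝ) 1 → |(|x|) - p.eval x| ≤ 2 * |x|) ∧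
      ∀ x : ℝ, x ∈ Set.Icc (-1 : ℝ) 1 → x ≠ 0 → |(|x|) - p.eval x| ≤ (π ^ 7 / 3) / ((L : ℝ) ^ 3 * x ^ 2) := by
  have hLr : (0 : ℝ) < L := by exact_mod_cast hL
  have abs_sign_le_one : ∀ y : ℝ, |Real.sign y| ≤ 1 := fun y => by
    rcases Real.sign_apply_eq y with h | h | h <;> rw [h] <;> norm_num
  obtain ⟨r, hdeg, hr1, hr2⟩ := exists_poly_near_sign_localized hL
  have hev : ∀ x : ℝ, (Polynomial.X * r).eval x = x * r.eval x := fun x => by rw [Polynomial.eval_mul, Polynomial.eval_X]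
  have hkey : ∀ x : ℝ, |x| - (Polynomial.X * r).eval x = x * (Real.sign x - r.eval x) := fun x => by
    rw [hev, mul_sub, self_mul_sign_eq_abs]
  refine ⟨Polynomial.X * r, ?_, fun x hx => ?_, fun x hx => ?_, fun x hx hx0 => ?_⟩
  · refine (Polynomial.natDegree_mul_le).trans ?_
    rw [Polynomial.natDegree_X]
    omega
  · rw [hev, abs_mul]
    exact mul_le_of_le_one_right (abs_nonneg x) (hr1 x hx)
  · rw [hkey, abs_mul]
    have h2 : |Real.sign x - r.eval x| ≤ 2 := by
      calc |Real.sign x - r.eval x| ≤ |Real.sign x| + |r.eval x| := abs_sub _ _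
        _ ≤ 1 + 1 := add_le_add (abs_sign_le_one x) (hr1 x hx)
        _ = 2 := by norm_num
    calc |x| * |Real.sign x - r.eval x| ≤ |x| * 2 := mul_le_mul_of_nonneg_left h2 (abs_nonneg x)
      _ = 2 * |x| := by ring
  · rw [hkey, abs_mul]
    have habs : 0 < |x| := abs_pos.2 hx0
    calc |x| * |Real.sign x - r.eval x| ≤ |x| * ((π ^ 7 / 3) / ((L : ℝ) * |x|) ^ 3) :=
          mul_le_mul_of_nonneg_left (hr2 x hx hx0) (abs_nonneg x)
      _ = (π ^ 7 / 3) / ((L : ℝ) ^ 3 * x ^ 2) := by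
          rw [← sq_abs x]; field_simp

end Summit.QuantumFields.YangMills.Theorems.BalabanUVNodesN19KinkExactSignJackson

end
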